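import Mathlib
import Summits.AtomisticToContinuum.Crystallization.Theses.HolmgrenBoyleLind
import Summits.AtomisticToContinuum.Crystallization.Theorems.HolmgrenBoyleLindHalfSpaceRigidityPeriodicLattice

/-!
# Route `HolmgrenBoyleLind`, item stmt-AtomisticToContinuum-6077 `HalfSpaceRigidityPeriodic`

**Theorem** (`holmgrenBoyleLind_halfSpaceRigidityPeriodic_proof`, closing the item): let `Λ ⊆ ℝ³` be
`δ`-separated, `r`-dense and of finite local complexity (finitely many `R`-patches
`{v | x + v ∈ Λ, ‖v‖ ≤ R}`, `x ∈ Λ`, for every `R`).  If no two distinct elements of the patch-hull of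
`Λ` (sets every closed central ball of which is an exact translate of a `Λ`-patch) agree on an open
half-space, then `Λ` is the point set `F + G` of a periodic configuration.

Elementary proof by FLC compactness (the transcription of Boyle–Lind-type half-space rigidity to
Delone sets needs no `ℤ³`-action):

* *Periodic alternative.*  If at some radius `R` any two points of `Λ` with equal `R`-patches have
  equal translates `Λ - p = Λ - q`, the periods of `Λ` span `ℝ³` and `Λ = F + G`
  (`span_periods_eq_top`, `exists_periodicConfiguration_of_span_eq_top`, file
  `HolmgrenBoyleLindHalfSpaceRigidityPeriodicLattice`).
* *Aperiodic alternative.*  Otherwise every radius carries a same-patch pair `p, q` with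
  `Λ - p ≠ Λ - q`.  `exists_recentred_pair`: recentre both translates at a common point `y` near the
  least-norm disagreement `z` (`‖z‖ > R`, `‖y - z‖ ≤ 3r`); the recentred translates disagree within
  radius `3r` of the origin and agree on the ball `B(-y, ‖y‖ + r)`, `‖y‖ ≥ R - 3r`.
  `exists_extraction`: by finite local complexity the patches of both recentred translates at every
  integer radius range over finite sets, so (sequential compactness of a countable product of finite
  sets times the unit sphere) a subsequence makes all of them eventually constant and the directions
  `y/‖y‖` converge to a unit vector `e`.  `exists_halfSpace_pair`: the exact local limits `ω, ω'` lie
  in the patch-hull, differ at a point of norm `≤ 3r`, and agree on the open half-space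
  `{z | ⟪z, e⟫ < 0}` (the balls `B(-y, ‖y‖ + r)` exhaust it) — contradicting the hypothesis.

References: Baake–Grimm, *Aperiodic Order* I (2013), Prop. 3.1 and §5.4 (local topology, FLC hull
compactness); Boyle–Lind, *Expansive subdynamics* (1997), Thm 3.7 for the `ℤᵈ` prototype.
-/

noncomputable section

namespace Summit.AtomisticToContinuum.Crystallization.Theorems.HolmgrenBoyleLind

open scoped BigOperators Topology InnerProductSpace
open Filter Set Metric
open Literature.MathematicalPhysics.StatisticalMechanics

/-! ## The aperiodic half: a recentred pair and its local limit -/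

/-- **Recentring.** If `p, q ∈ Λ` have the same `R`-patch (`R ≥ 3r`) but `Λ - p ≠ Λ - q`, let `z` be a
point of least norm in the (locally finite, non-empty) disagreement set of `Λ - p` and `Λ - q`
(`‖z‖ > R`) and `y` a common point of `Λ - p`, `Λ - q` within `r` of `(1 - 2r/‖z‖) z`; recentring
both at `y` gives `a = p + y`, `b = q + y ∈ Λ` whose translates `Λ - a`, `Λ - b` disagree at
`d = z - y` (`‖d‖ ≤ 3r`) and agree on the open ball of radius `‖y‖ + r` about `-y`, where
`‖y‖ ≥ R - 3r`. [folklore] -/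
theorem exists_recentred_pair {Λ : Set (EuclideanSpace ℝ (Fin 3))} {δ r R : ℝ} (hδ : 0 < δ)
    (hr : 0 < r) (hsep : ∀ x ∈ Λ, ∀ y ∈ Λ, x ≠ y → δ ≤ dist x y)
    (hden : ∀ c : EuclideanSpace ℝ (Fin 3), ∃ y ∈ Λ, dist y c ≤ r) (hR : 3 * r ≤ R)
    {p q : EuclideanSpace ℝ (Fin 3)}
    (hpatch : {v : EuclideanSpace ℝ (Fin 3) | p + v ∈ Λ ∧ ‖v‖ ≤ R} =
      {v : EuclideanSpace ℝ (Fin 3) | q + v ∈ Λ ∧ ‖v‖ ≤ R})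
    (hne : {v : EuclideanSpace ℝ (Fin 3) | p + v ∈ Λ} ≠ {v : EuclideanSpace ℝ (Fin 3) | q + v ∈ Λ}) :
    ∃ Y d : EuclideanSpace ℝ (Fin 3), p + Y ∈ Λ ∧ q + Y ∈ Λ ∧ R - 3 * r ≤ ‖Y‖ ∧ ‖d‖ ≤ 3 * r ∧
      ¬ (p + Y + d ∈ Λ ↔ q + Y + d ∈ Λ) ∧
      ∀ w : EuclideanSpace ℝ (Fin 3), ‖w + Y‖ < ‖Y‖ + r → (p + Y + w ∈ Λ ↔ q + Y + w ∈ Λ) := by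
  classical
  -- the disagreement set, non-empty and locally finite
  set D : Set (EuclideanSpace ℝ (Fin 3)) := {w | ¬ (p + w ∈ Λ ↔ q + w ∈ Λ)} with hD
  have hDne : D.Nonempty := by
    by_contra h
    apply hne
    ext v
    simp only [Set.mem_setOf_eq]
    by_contra hv
    exact h ⟨v, hv⟩
  obtain ⟨w₀, hw₀⟩ := hDne
  have hfin : (closedBall (0 : EuclideanSpace ℝ (Fin 3)) ‖w₀‖ ∩ D).Finite := by
    refine ((finite_inter_of_le_dist hδ (le_dist_of_mem_translate hsep p)
      (isBounded_closedBall (x := (0 : EuclideanSpace ℝ (Fin 3))) (r := ‖w₀‖))).union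
      (finite_inter_of_le_dist hδ (le_dist_of_mem_translate hsep q)
        (isBounded_closedBall (x := (0 : EuclideanSpace ℝ (Fin 3))) (r := ‖w₀‖)))).subset ?_
    rintro w ⟨hw1, hw2⟩
    by_cases h : p + w ∈ Λ
    · exact Or.inl ⟨hw1, h⟩
    · right
      refine ⟨hw1, ?_⟩
      simp only [hD, Set.mem_setOf_eq] at hw2 ⊢
      tauto
  obtain ⟨z, ⟨hzB, hzD⟩, hzmin⟩ :=
    Set.exists_min_image _ (fun w => ‖w‖) hfin ⟨w₀, mem_closedBall_zero_iff.2 le_rfl, hw₀⟩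
  have hmin : ∀ w ∈ D, ‖z‖ ≤ ‖w‖ := by
    intro w hw
    by_cases h : ‖w‖ ≤ ‖w₀‖
    · exact hzmin w ⟨mem_closedBall_zero_iff.2 h, hw⟩
    · have h' : ‖z‖ ≤ ‖w₀‖ := mem_closedBall_zero_iff.1 hzB
      push Not at h
      exact h'.trans h.le
  -- the least disagreement radius exceeds `R`
  have hzR : R < ‖z‖ := by
    by_contra h
    push Not at h
    apply hzD
    have h' := Set.ext_iff.1 hpatch z
    simp only [Set.mem_setOf_eq] at h'
    exact ⟨fun hpz => (h'.1 ⟨hpz, h⟩).1, fun hqz => (h'.2 ⟨hqz, h⟩).1⟩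
  have hρ0 : 0 < ‖z‖ := by linarith
  -- the recentring point
  set c : EuclideanSpace ℝ (Fin 3) := (1 - 2 * r / ‖z‖) • z with hc
  have hcoef : 0 ≤ 1 - 2 * r / ‖z‖ := by
    rw [sub_nonneg, div_le_one hρ0]; linarith
  have hnc : ‖c‖ = ‖z‖ - 2 * r := by
    rw [hc, norm_smul, Real.norm_of_nonneg hcoef, sub_mul, one_mul, div_mul_cancel₀ _ hρ0.ne']
  have hzc : ‖z - c‖ = 2 * r := by
    have h' : z - c = (2 * r / ‖z‖) • z := by rw [hc, sub_smul, one_smul, sub_sub_cancel]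
    rw [h', norm_smul, Real.norm_of_nonneg (by positivity), div_mul_cancel₀ _ hρ0.ne']
  obtain ⟨y', hy'Λ, hy'c⟩ := hden (p + c)
  set y : EuclideanSpace ℝ (Fin 3) := y' - p with hy
  have hpy : p + y ∈ Λ := by simpa [hy] using hy'Λ
  have hyc : ‖y - c‖ ≤ r := by
    rw [dist_eq_norm] at hy'c
    have h' : y' - (p + c) = y - c := by rw [hy]; abel
    rwa [h'] at hy'c
  clear_value y
  clear hy
  have hny : ‖y‖ ≤ ‖z‖ - r := by
    calc ‖y‖ = ‖(y - c) + c‖ := by rw [sub_add_cancel]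
      _ ≤ ‖y - c‖ + ‖c‖ := norm_add_le _ _
      _ ≤ r + (‖z‖ - 2 * r) := add_le_add hyc hnc.le
      _ = ‖z‖ - r := by ring
  have hny' : ‖z‖ - 3 * r ≤ ‖y‖ := by
    have h' : ‖c‖ - ‖y‖ ≤ ‖y - c‖ := by
      rw [← norm_sub_rev c y]
      exact norm_sub_norm_le c y
    linarith
  have hyD : y ∉ D := fun h => by have h' := hmin y h; linarith
  have hqy : q + y ∈ Λ := by
    simp only [hD, Set.mem_setOf_eq, not_not] at hyD
    exact hyD.1 hpy
  refine ⟨y, z - y, hpy, hqy, by linarith, ?_, ?_, ?_⟩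
  · calc ‖z - y‖ = ‖(z - c) + (c - y)‖ := by rw [sub_add_sub_cancel]
      _ ≤ ‖z - c‖ + ‖c - y‖ := norm_add_le _ _
      _ ≤ 2 * r + r := by rw [hzc, norm_sub_rev]; linarith
      _ = 3 * r := by ring
  · have e1 : p + y + (z - y) = p + z := by abel
    have e2 : q + y + (z - y) = q + z := by abel
    rw [e1, e2]
    exact hzD
  · intro w hw
    have hwD : w + y ∉ D := by
      intro h
      have h' := hmin _ h
      linarith
    simp only [hD, Set.mem_setOf_eq, not_not] at hwD
    have e1 : p + y + w = p + (w + y) := by abel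
    have e2 : q + y + w = q + (w + y) := by abel
    rw [e1, e2]
    exact hwD

/-- **Diagonal extraction (finite local complexity compactness).** Two sequences of labels in
finite classes `F R`, `R : ℕ`, and a sequence of non-zero vectors admit a common subsequence along
which every label is eventually constant and the directions converge on the unit sphere
(sequential compactness of `(Π_R F R × F R) × 𝕊²`). [folklore] -/
theorem exists_extraction {F : ℕ → Set (Set (EuclideanSpace ℝ (Fin 3)))} (hF : ∀ R, (F R).Finite)
    (A B : ℕ → ℕ → Set (EuclideanSpace ℝ (Fin 3))) (hA : ∀ n R, A n R ∈ F R) (hB : ∀ n R, B n R ∈ F R)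
    (Y : ℕ → EuclideanSpace ℝ (Fin 3)) (hY : ∀ n, Y n ≠ 0) :
    ∃ φ : ℕ → ℕ, StrictMono φ ∧
      (∃ e : EuclideanSpace ℝ (Fin 3), ‖e‖ = 1 ∧
        Tendsto (fun k => ‖Y (φ k)‖⁻¹ • Y (φ k)) atTop (𝓝 e)) ∧
      ∀ R, ∃ SA SB : Set (EuclideanSpace ℝ (Fin 3)), ∀ᶠ k in atTop, A (φ k) R = SA ∧ B (φ k) R = SB := by
  classical
  haveI : ∀ R, Finite ↥(F R) := fun R => (hF R).to_subtype
  letI : ∀ R, TopologicalSpace ↥(F R) := fun _ => ⊥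
  haveI : ∀ R, DiscreteTopology ↥(F R) := fun _ => ⟨rfl⟩
  let s : ℕ → ((R : ℕ) → ↥(F R) × ↥(F R)) × ↥(sphere (0 : EuclideanSpace ℝ (Fin 3)) 1) := fun n =>
    (fun R => (⟨A n R, hA n R⟩, ⟨B n R, hB n R⟩),
      ⟨‖Y n‖⁻¹ • Y n, by simp [norm_smul, hY n]⟩)
  obtain ⟨⟨L, e⟩, φ, hφ, hlim⟩ := CompactSpace.tendsto_subseq s
  refine ⟨φ, hφ, ⟨e, by simp, ?_⟩, fun R => ?_⟩
  · exact (continuous_subtype_val.tendsto e).comp ((continuous_snd.tendsto _).comp hlim)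
  · have h1 := ((continuous_apply R).tendsto L).comp ((continuous_fst.tendsto _).comp hlim)
    rw [nhds_discrete] at h1
    refine ⟨(L R).1.1, (L R).2.1, ?_⟩
    filter_upwards [tendsto_pure.1 h1] with k hk
    have hk' : (s (φ k)).1 R = L R := hk
    exact ⟨congrArg (fun x => (x.1 : Set (EuclideanSpace ℝ (Fin 3)))) hk',
      congrArg (fun x => (x.2 : Set (EuclideanSpace ℝ (Fin 3)))) hk'⟩

/-- **A distinct pair of hull elements agreeing on an open half-space.** If a `δ`-separated,
`r`-dense set `Λ ⊆ ℝ³` of finite local complexity has, at every radius `R`, two points with equal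
`R`-patches whose difference is not a period, then the patch-hull of `Λ` (sets all of whose
central patches are translates of `Λ`-patches) contains `ω ≠ ω'` that coincide on an open
half-space through `0`: recentre the pairs (`exists_recentred_pair`), extract a subsequence along
which all patches of both recentred translates are eventually constant and the recentring
directions `Y/‖Y‖` converge to `e` (`exists_extraction`), and pass to the exact local limits; the
agreement balls `B(-Y, ‖Y‖ + r)` exhaust the half-space `{⟪z, e⟫ < 0}`, while the disagreement
points (norm `≤ 3r`) keep the limits distinct (Baake–Grimm 2013, §5.4, local topology / FLC
compactness). [folklore] -/
theorem exists_halfSpace_pair {Λ : Set (EuclideanSpace ℝ (Fin 3))} {δ r : ℝ} (hδ : 0 < δ) (hr : 0 < r)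
    (hsep : ∀ x ∈ Λ, ∀ y ∈ Λ, x ≠ y → δ ≤ dist x y)
    (hden : ∀ c : EuclideanSpace ℝ (Fin 3), ∃ y ∈ Λ, dist y c ≤ r)
    (hFLC : ∀ R : ℝ, Set.Finite {S : Set (EuclideanSpace ℝ (Fin 3)) |
      ∃ x ∈ Λ, S = {v : EuclideanSpace ℝ (Fin 3) | x + v ∈ Λ ∧ ‖v‖ ≤ R}})
    (hpairs : ∀ R : ℝ, ∃ p ∈ Λ, ∃ q ∈ Λ,
      {v : EuclideanSpace ℝ (Fin 3) | p + v ∈ Λ ∧ ‖v‖ ≤ R} =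
        {v : EuclideanSpace ℝ (Fin 3) | q + v ∈ Λ ∧ ‖v‖ ≤ R} ∧
      {v : EuclideanSpace ℝ (Fin 3) | p + v ∈ Λ} ≠ {v : EuclideanSpace ℝ (Fin 3) | q + v ∈ Λ}) :
    ∃ ω ω' : Set (EuclideanSpace ℝ (Fin 3)),
      (∀ R : ℝ, ∃ v : EuclideanSpace ℝ (Fin 3),
        {z : EuclideanSpace ℝ (Fin 3) | z ∈ ω ∧ ‖z‖ ≤ R} =
          {z : EuclideanSpace ℝ (Fin 3) | z + v ∈ Λ ∧ ‖z‖ ≤ R}) ∧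
      (∀ R : ℝ, ∃ v : EuclideanSpace ℝ (Fin 3),
        {z : EuclideanSpace ℝ (Fin 3) | z ∈ ω' ∧ ‖z‖ ≤ R} =
          {z : EuclideanSpace ℝ (Fin 3) | z + v ∈ Λ ∧ ‖z‖ ≤ R}) ∧
      ∃ u : EuclideanSpace ℝ (Fin 3), u ≠ 0 ∧
        (∀ z : EuclideanSpace ℝ (Fin 3), ⟪z, u⟫_ℝ < 0 → (z ∈ ω ↔ z ∈ ω')) ∧ ω ≠ ω' := by
  classical
  -- recentred pairs at every scale `n`
  have hdata : ∀ n : ℕ, ∃ a ∈ Λ, ∃ b ∈ Λ, ∃ Y d : EuclideanSpace ℝ (Fin 3),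
      (n : ℝ) + 1 ≤ ‖Y‖ ∧ ‖d‖ ≤ 3 * r ∧ ¬ (a + d ∈ Λ ↔ b + d ∈ Λ) ∧
      ∀ w : EuclideanSpace ℝ (Fin 3), ‖w + Y‖ < ‖Y‖ + r → (a + w ∈ Λ ↔ b + w ∈ Λ) := by
    intro n
    obtain ⟨p, -, q, -, hpatch, hne⟩ := hpairs ((n : ℝ) + 1 + 3 * r)
    obtain ⟨Y, d, hpY, hqY, hY, hd, hdis, hagree⟩ :=
      exists_recentred_pair hδ hr hsep hden (by linarith) hpatch hne
    exact ⟨p + Y, hpY, q + Y, hqY, Y, d, by linarith, hd, hdis, hagree⟩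
  choose a ha b hb Y d hYn hd hdis hagree using hdata
  have hYne : ∀ n, Y n ≠ 0 := fun n h => by
    have h' := hYn n
    rw [h, norm_zero] at h'
    linarith [n.cast_nonneg (α := ℝ)]
  -- extraction
  obtain ⟨φ, hφ, ⟨e, he, hlim⟩, hconst⟩ := exists_extraction
    (F := fun R : ℕ => {S : Set (EuclideanSpace ℝ (Fin 3)) |
      ∃ x ∈ Λ, S = {v : EuclideanSpace ℝ (Fin 3) | x + v ∈ Λ ∧ ‖v‖ ≤ (R : ℝ)}})
    (fun R => hFLC R)
    (fun n R => {v : EuclideanSpace ℝ (Fin 3) | a n + v ∈ Λ ∧ ‖v‖ ≤ (R : ℝ)})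
    (fun n R => {v : EuclideanSpace ℝ (Fin 3) | b n + v ∈ Λ ∧ ‖v‖ ≤ (R : ℝ)})
    (fun n R => ⟨a n, ha n, rfl⟩) (fun n R => ⟨b n, hb n, rfl⟩) Y hYne
  -- stability: along the subsequence, membership `x (φ k) + z ∈ Λ` is eventually constant,
  -- uniformly for `z` in a ball
  have hstab : ∀ x : ℕ → EuclideanSpace ℝ (Fin 3),
      (∀ R : ℕ, ∃ S : Set (EuclideanSpace ℝ (Fin 3)), ∀ᶠ k in atTop,
        {v : EuclideanSpace ℝ (Fin 3) | x (φ k) + v ∈ Λ ∧ ‖v‖ ≤ (R : ℝ)} = S) →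
      ∀ R : ℕ, ∀ᶠ k in atTop, ∀ z : EuclideanSpace ℝ (Fin 3), ‖z‖ ≤ R →
        (x (φ k) + z ∈ Λ ↔ ∀ᶠ j in atTop, x (φ j) + z ∈ Λ) := by
    intro x hx R
    obtain ⟨S, hS⟩ := hx R
    filter_upwards [hS] with k hk z hz
    have h1 : ∀ j, {v : EuclideanSpace ℝ (Fin 3) | x (φ j) + v ∈ Λ ∧ ‖v‖ ≤ (R : ℝ)} = S →
        (x (φ j) + z ∈ Λ ↔ z ∈ S) := by
      intro j hj
      rw [← hj]
      simp only [Set.mem_setOf_eq]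
      exact ⟨fun h => ⟨h, hz⟩, fun h => h.1⟩
    rw [h1 k hk, Filter.eventually_congr (hS.mono fun j hj => h1 j hj), Filter.eventually_const]
  have hstabA := hstab a fun R => by
    obtain ⟨SA, _SB, h⟩ := hconst R
    exact ⟨SA, h.mono fun k hk => hk.1⟩
  have hstabB := hstab b fun R => by
    obtain ⟨_SA, SB, h⟩ := hconst R
    exact ⟨SB, h.mono fun k hk => hk.2⟩
  -- hull membership of the local limits
  have hhull : ∀ x : ℕ → EuclideanSpace ℝ (Fin 3),
      (∀ R : ℕ, ∀ᶠ k in atTop, ∀ z : EuclideanSpace ℝ (Fin 3), ‖z‖ ≤ R →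
        (x (φ k) + z ∈ Λ ↔ ∀ᶠ j in atTop, x (φ j) + z ∈ Λ)) →
      ∀ R : ℝ, ∃ v : EuclideanSpace ℝ (Fin 3),
        {z : EuclideanSpace ℝ (Fin 3) | z ∈ {z : EuclideanSpace ℝ (Fin 3) |
            ∀ᶠ j in atTop, x (φ j) + z ∈ Λ} ∧ ‖z‖ ≤ R} =
          {z : EuclideanSpace ℝ (Fin 3) | z + v ∈ Λ ∧ ‖z‖ ≤ R} := by
    intro x hx R
    obtain ⟨k, hk⟩ := (hx ⌈R⌉₊).exists
    refine ⟨x (φ k), Set.ext fun z => ?_⟩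
    simp only [Set.mem_setOf_eq]
    constructor
    · rintro ⟨hz, hzR⟩
      refine ⟨?_, hzR⟩
      rw [add_comm]
      exact (hk z (hzR.trans (Nat.le_ceil R))).2 hz
    · rintro ⟨hz, hzR⟩
      rw [add_comm] at hz
      exact ⟨(hk z (hzR.trans (Nat.le_ceil R))).1 hz, hzR⟩
  -- the local limits
  refine ⟨{z | ∀ᶠ k in atTop, a (φ k) + z ∈ Λ}, {z | ∀ᶠ k in atTop, b (φ k) + z ∈ Λ},
    hhull a hstabA, hhull b hstabB, e, norm_ne_zero_iff.1 (by rw [he]; exact one_ne_zero), ?_, ?_⟩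
  · -- agreement on the open half-space `{⟪z, e⟫ < 0}`
    intro z hz
    simp only [Set.mem_setOf_eq]
    apply Filter.eventually_congr
    have hnorm : Tendsto (fun k => ‖Y (φ k)‖) atTop atTop := by
      refine tendsto_atTop_mono (fun k => ?_) (tendsto_natCast_atTop_atTop.comp hφ.tendsto_atTop)
      have h' := hYn (φ k)
      simp only [Function.comp_apply]
      linarith
    have hinner : Tendsto (fun k => ⟪z, ‖Y (φ k)‖⁻¹ • Y (φ k)⟫_ℝ) atTop (𝓝 ⟪z, e⟫_ℝ) :=
      tendsto_const_nhds.inner hlim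
    have hz2 : ⟪z, e⟫_ℝ < ⟪z, e⟫_ℝ / 2 := by linarith
    have hneg : 0 < -(⟪z, e⟫_ℝ / 2) := by linarith
    filter_upwards [hinner.eventually (gt_mem_nhds hz2),
      hnorm.eventually_gt_atTop (‖z‖ ^ 2 / (-(⟪z, e⟫_ℝ / 2)))] with k hk1 hk2
    apply hagree
    have hW0 : 0 < ‖Y (φ k)‖ := norm_pos_iff.2 (hYne _)
    have hzW : ⟪z, Y (φ k)⟫_ℝ = ‖Y (φ k)‖ * ⟪z, ‖Y (φ k)‖⁻¹ • Y (φ k)⟫_ℝ := by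
      rw [real_inner_smul_right, ← mul_assoc, mul_inv_cancel₀ hW0.ne', one_mul]
    have h3 : ‖z‖ ^ 2 < ‖Y (φ k)‖ * (-(⟪z, e⟫_ℝ / 2)) := by
      rwa [div_lt_iff₀ hneg] at hk2
    have h4 : ⟪z, Y (φ k)⟫_ℝ ≤ ‖Y (φ k)‖ * (⟪z, e⟫_ℝ / 2) := by
      rw [hzW]
      exact mul_le_mul_of_nonneg_left hk1.le hW0.le
    have hsq : ‖z + Y (φ k)‖ ^ 2 < ‖Y (φ k)‖ ^ 2 := by
      rw [norm_add_sq_real]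
      nlinarith
    have hlt : ‖z + Y (φ k)‖ < ‖Y (φ k)‖ := lt_of_pow_lt_pow_left₀ 2 (norm_nonneg _) hsq
    linarith
  · -- the limits disagree at a point of norm `≤ 3r`
    intro hEq
    obtain ⟨k, hka, hkb⟩ := ((hstabA ⌈3 * r⌉₊).and (hstabB ⌈3 * r⌉₊)).exists
    have hdk : ‖d (φ k)‖ ≤ (⌈3 * r⌉₊ : ℝ) := (hd (φ k)).trans (Nat.le_ceil _)
    apply hdis (φ k)
    rw [hka (d (φ k)) hdk, hkb (d (φ k)) hdk]
    have h' := Set.ext_iff.1 hEq (d (φ k))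
    simpa only [Set.mem_setOf_eq] using h'

end Summit.AtomisticToContinuum.Crystallization.Theorems.HolmgrenBoyleLind

namespace Summit.AtomisticToContinuum.Crystallization.Theorems

open scoped InnerProductSpace
open Summit.AtomisticToContinuum.Crystallization.Theorems.HolmgrenBoyleLind

/-- **Item stmt-AtomisticToContinuum-6077** (`HalfSpaceRigidityPeriodic`, route `HolmgrenBoyleLind`):
a `δ`-separated, `r`-dense subset `Λ ⊆ ℝ³` of finite local complexity, no two distinct elements of
whose patch-hull agree on an open half-space, is the point set of a periodic configuration.
Proof: either at some radius `R` equal `R`-patches force equal translates — then the periods span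
`ℝ³` (`span_periods_eq_top`) and `Λ = F + G` (`exists_periodicConfiguration_of_span_eq_top`) — or at
every radius there is a same-patch pair with non-period difference, and the FLC local limit of the
recentred pairs is a distinct pair of hull elements agreeing on an open half-space
(`exists_halfSpace_pair`), excluded by hypothesis. [folklore] -/
theorem holmgrenBoyleLind_halfSpaceRigidityPeriodic_proof :
    Summit.AtomisticToContinuum.Crystallization.Theses.HolmgrenBoyleLind.HalfSpaceRigidityPeriodic := by
  unfold Summit.AtomisticToContinuum.Crystallization.Theses.HolmgrenBoyleLind.HalfSpaceRigidityPeriodic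
  intro Λ δ r hδ hr hsep hden hFLC hHS
  by_cases hcase : ∃ R : ℝ, ∀ p ∈ Λ, ∀ q ∈ Λ,
      {v : EuclideanSpace ℝ (Fin 3) | p + v ∈ Λ ∧ ‖v‖ ≤ R} =
        {v : EuclideanSpace ℝ (Fin 3) | q + v ∈ Λ ∧ ‖v‖ ≤ R} →
      {v : EuclideanSpace ℝ (Fin 3) | p + v ∈ Λ} = {v : EuclideanSpace ℝ (Fin 3) | q + v ∈ Λ}
  · obtain ⟨R, hR⟩ := hcase
    refine exists_periodicConfiguration_of_span_eq_top hδ hsep hden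
      (span_periods_eq_top hden (hFLC R) fun p hp q hq hpq x => ?_)
    have h := Set.ext_iff.1 (hR p hp q hq hpq) (x - p)
    simp only [Set.mem_setOf_eq, add_sub_cancel] at h
    rw [show x + (q - p) = q + (x - p) by abel]
    exact h.symm
  · push Not at hcase
    exfalso
    obtain ⟨ω, ω', hω, hω', u, hu, hagree, hne⟩ :=
      exists_halfSpace_pair hδ hr hsep hden hFLC fun R => by
        obtain ⟨p, hp, q, hq, h1, h2⟩ := hcase R
        exact ⟨p, hp, q, hq, h1, h2⟩
    exact hne (hHS ω ω' hω hω' u 0 hu hagree)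

end Summit.AtomisticToContinuum.Crystallization.Theorems

end
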